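import Summits.QuantumFields.YangMills.Theorems.VirialFluxGapCentralSignPlug
import Summits.QuantumFields.YangMills.Theorems.VirialFluxGapCentralMassMonotonicityWindow
import Summits.QuantumFields.YangMills.Theorems.VirialFluxGapCentralFieldSmooth
import HarnessLib

/-!
# Route `VirialFluxGap` (YangMills): `PeriodicSoftness` FROM THE DRIVE (P2) AND DIVERGENCE (P3) OF THE EXPLICIT CENTRAL FIELD ALONE
# (assembly Part VIII: the smoothness and the mass monotonicity (P4) of `centralCoeff` are discharged; `N = 330L²`, `t_C ≤ (110000L⁴)⁻¹`)

Toward the deciding crux `VirialFluxGap.PeriodicSoftness` (item stmt-QuantumFields-24141).  ✓`periodicSoftness_of_signPlug` (Part VII) asks, per sign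
pattern, for (P2) drive, (P3) divergence, (P4) mass monotonicity of a per-sign family `Φ σ σ₄`, plus smoothness of the selector-plugged family.  For
w3's explicit field `Φ = centralCoeff L` two of these are now in the tree: smoothness (w2 ✓`contDiff_centralCoeff_sign`) and (P4)
(✓`central_linkMass_bracket_lower_window` ∕ ✓`central_seamMass_bracket_lower_window`, `N = 330L²`, on the window `mass ≤ ¼`, `F_fix ≤ (110000L⁴)⁻¹`).
Hence ★★★ `periodicSoftness_of_centralDrive`: `PeriodicSoftness` BY NAME follows from (P2) and (P3) ALONE for `centralCoeff L σ σ₄` — for all large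
`L`: `ρ ∈ [(K_C L^{q_C})⁻¹, ½]`, `t_C ∈ [(K_C L^{q_C})⁻¹, (110000L⁴)⁻¹]`, `ε_C·L⁴ ≤ 1/400`, and at every `X_fix` point of the closed `ρ`-central
window carrying the signs `σ_k, σ₄ = ±1`: (P2) `2(1−ε_C)F_fix ≤ Σ_va centralCoeff·frameGrad`, (P3) `Σ_va ∂_va centralCoeff_va ≤ 18L⁴ − ½`.

HONEST LABEL: a CONDITIONAL reduction ((P2), (P3) are HYPOTHESES — w3 lineage: Euler-defect drive F1–F3, per-slot divergences + w2's
✓`centralDiv_le_budget`); nothing is closed; ⟨24141⟩, ⟨22884⟩ remain OPEN; the Yang–Mills mass gap is NOT proved; no summit is proved by a line.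
THEOREMS ONLY (0 `def`, 0 `sorry`), standard axioms.  Explicit-unit seat `ym-line-fcl-p3` g41 (cell ym-idea-1, free hands; assembler),
`--supports stmt-QuantumFields-24141`.  References: [cite: Luscher1983, §2]; [cite: CosteEtAl1985]; [folklore].
-/

set_option autoImplicit false

noncomputable section

open scoped Matrix BigOperators ContDiff Topology Quaternion
open MeasureTheory Set Matrix
open Literature.MathematicalPhysics.QuantumFieldTheory hiding SU2
open Literature.MathematicalPhysics.QuantumLattice
open Literature.MathematicalPhysics.QuantumFieldTheory.SUNBakryEmery (expSU coe_expSU matTop)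

namespace Summit.QuantumFields.YangMills.Theorems.VirialFluxGap.FrameHessian

open Summit.QuantumFields.YangMills.Theorems.FemtoTransferGap
open Summit.QuantumFields.YangMills.Theorems.FemtoTransferGap.TT
open Summit.QuantumFields.YangMills.Theorems.FemtoTransferGap.TwoLattice
open Summit.QuantumFields.YangMills.Theorems.FemtoTransferGap.TwoLattice.Flat
open Summit.QuantumFields.YangMills.Theorems.VirialFluxGap.RingDeficit
open Summit.QuantumFields.YangMills.Theorems.VirialFluxGap.FrameDerivative
open Summit.QuantumFields.YangMills.Theorems.VirialFluxGap.FixFrame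
open Summit.QuantumFields.YangMills.Theorems.VirialFluxGap.RegCutoff
open Summit.QuantumFields.YangMills.Theorems.VirialFluxGap.CentralField

variable {L : ℕ} [NeZero L]

open scoped Matrix.Norms.Frobenius

omit [NeZero L] in
/-- Letter: `330·L² ≤ max(K_C, 330)·L^{max(q_C, 2)}` for `L ≥ 1`, `K_C ≥ 1`. [folklore] -/
theorem rate_le_pow {K_C : ℝ} (hK_C : 1 ≤ K_C) (q_C : ℕ) (hL : (1 : ℝ) ≤ L) :
    330 * (L : ℝ) ^ 2 ≤ max K_C 330 * (L : ℝ) ^ (max q_C 2) ∧ K_C * (L : ℝ) ^ q_C ≤ max K_C 330 * (L : ℝ) ^ (max q_C 2) := by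
  have hL0 : (0 : ℝ) ≤ L := by linarith
  constructor
  · exact mul_le_mul (le_max_right _ _) (pow_le_pow_right₀ hL (le_max_right _ _)) (by positivity) (by positivity)
  · exact mul_le_mul (le_max_left _ _) (pow_le_pow_right₀ hL (le_max_left _ _)) (by positivity) (le_trans (by norm_num) (le_max_right _ _))

/-- ★★★ **`PeriodicSoftness` FROM (P2) AND (P3) OF THE EXPLICIT CENTRAL FIELD.**  If for all large `L` there are `ρ ∈ [(K_C L^{q_C})⁻¹, ½]`,
`t_C ∈ [(K_C L^{q_C})⁻¹, (110000·L⁴)⁻¹]` and `ε_C` with `ε_C·L⁴ ≤ 1/400` such that for all signs `σ_k, σ₄ = ±1`, at every `x ∈ X_fix` with all four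
regularity masses `≤ ρ²`, `½ ≤ σ_k·Re q(w_k)`, `½ ≤ σ₄·Re q(seam root)` and `F_fix x ≤ t_C`:
(P2) `2(1−ε_C)·F_fix x ≤ Σ_va centralCoeff L σ σ₄ va M_x · frameGrad fixFrameStd M_x va` and
(P3) `Σ_va frameD (fixFrameStd va) (centralCoeff L σ σ₄ va) M_x ≤ 18L⁴ − ½`,
then the deciding crux `VirialFluxGap.PeriodicSoftness` holds BY NAME — (P4) and smoothness are supplied here (✓`central_*Mass_bracket_lower_window`,
✓`contDiff_centralCoeff_sign`), the rest is ✓`periodicSoftness_of_signPlug`.  CONDITIONAL on (P2), (P3) (w3 lineage). [cite: Luscher1983, §2] -/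
theorem periodicSoftness_of_centralDrive
    (h : ∃ K_C : ℝ, 1 ≤ K_C ∧ ∃ q_C : ℕ, ∃ L₀ : ℕ, ∀ (L : ℕ) [NeZero L], L₀ ≤ L →
      ∃ (ρ t_C ε_C : ℝ),
        (K_C * (L : ℝ) ^ q_C)⁻¹ ≤ ρ ∧ ρ ≤ 1 / 2 ∧ (K_C * (L : ℝ) ^ q_C)⁻¹ ≤ t_C ∧ t_C ≤ (110000 * (L : ℝ) ^ 4)⁻¹ ∧
        ε_C * (L : ℝ) ^ 4 ≤ 1 / 400 ∧
        ∀ (σ : Fin 3 → ℝ) (σ₄ : ℝ), (∀ k, σ k = 1 ∨ σ k = -1) → (σ₄ = 1 ∨ σ₄ = -1) →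
          ∀ x : (OffIdx L → SU2) × ((Fin (2 * L - 1) → GaugeConfig 3 L SU2) × (Site 3 L → SU2)),
          (∀ k : Fin 3, 1 - (su2Quat (wrapReps ((Fin.cons (glue x.1) x.2.1 : Fin (2 * L - 1 + 1) → GaugeConfig 3 L SU2) 0) k)).re ^ 2 ≤ ρ ^ 2) →
          1 - (su2Quat (x.2.2 0)).re ^ 2 ≤ ρ ^ 2 →
          (∀ k : Fin 3, 1 / 2 ≤ σ k * (su2Quat (wrapReps ((Fin.cons (glue x.1) x.2.1 : Fin (2 * L - 1 + 1) → GaugeConfig 3 L SU2) 0) k)).re) →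
          1 / 2 ≤ σ₄ * (su2Quat (x.2.2 0)).re →
          ringDeficit L (fun _ => false) ((Fin.cons (glue x.1) x.2.1 : Fin (2 * L - 1 + 1) → GaugeConfig 3 L SU2), x.2.2) ≤ t_C →
          2 * (1 - ε_C) * ringDeficit L (fun _ => false) ((Fin.cons (glue x.1) x.2.1 : Fin (2 * L - 1 + 1) → GaugeConfig 3 L SU2), x.2.2) ≤
              ∑ va, centralCoeff L σ σ₄ va (ringCoord L ((Fin.cons (glue x.1) x.2.1 : Fin (2 * L - 1 + 1) → GaugeConfig 3 L SU2), x.2.2)) *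
                frameGrad (L := L) fixFrameStd (ringCoord L ((Fin.cons (glue x.1) x.2.1 : Fin (2 * L - 1 + 1) → GaugeConfig 3 L SU2), x.2.2)) va ∧
            ∑ va, frameD (fixFrameStd va) (centralCoeff L σ σ₄ va)
                (ringCoord L ((Fin.cons (glue x.1) x.2.1 : Fin (2 * L - 1 + 1) → GaugeConfig 3 L SU2), x.2.2)) ≤ 18 * (L : ℝ) ^ 4 - 1 / 2) :
    Summit.QuantumFields.YangMills.Theses.VirialFluxGap.PeriodicSoftness := by
  obtain ⟨K_C, hK_C, q_C, L₀, hpack⟩ := h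
  refine periodicSoftness_of_signPlug ⟨max K_C 330, le_trans hK_C (le_max_left _ _), max q_C 2, L₀, fun L _ hL => ?_⟩
  obtain ⟨ρ, t_C, ε_C, hρlo, hρhi, htClo, htChi, hεC, hP⟩ := hpack L hL
  have hL1 : (1 : ℝ) ≤ L := by exact_mod_cast NeZero.one_le
  have hL0 : (0 : ℝ) < L := by positivity
  obtain ⟨hrate, hKq⟩ := rate_le_pow hK_C q_C hL1
  have hKC0 : 0 < K_C := by linarith
  have hbig0 : 0 < K_C * (L : ℝ) ^ q_C := by positivity
  have hinv : (max K_C 330 * (L : ℝ) ^ (max q_C 2))⁻¹ ≤ (K_C * (L : ℝ) ^ q_C)⁻¹ := by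
    rw [inv_le_inv₀ (lt_of_lt_of_le hbig0 hKq) hbig0]; exact hKq
  have hρ2 : ρ ^ 2 ≤ 1 / 4 := by
    have hρ0 : 0 < ρ := lt_of_lt_of_le (by positivity) hρlo
    nlinarith only [hρ0, hρhi]
  refine ⟨ρ, t_C, 330 * (L : ℝ) ^ 2, ε_C, fun σ σ₄ => centralCoeff L σ σ₄, hinv.trans hρlo, hρhi, hinv.trans htClo, by positivity, hrate, hεC,
    fun va => contDiff_centralCoeff_sign (L := L) va, ?_⟩
  intro σ σ₄ hσ hσ₄ x hk hs hhk hhs hF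
  obtain ⟨h2, h3⟩ := hP σ σ₄ hσ hσ₄ x hk hs hhk hhs hF
  have hF' : ringDeficit L (fun _ => false) ((Fin.cons (glue x.1) x.2.1 : Fin (2 * L - 1 + 1) → GaugeConfig 3 L SU2), x.2.2) ≤
      (110000 * (L : ℝ) ^ 4)⁻¹ := hF.trans htChi
  exact ⟨h2, h3, fun k => central_linkMass_bracket_lower_window (L := L) hσ σ₄ x k (hhk k) ((hk k).trans hρ2) hF',
    central_seamMass_bracket_lower_window (L := L) σ hσ₄ x hhs (hs.trans hρ2) hF'⟩

end Summit.QuantumFields.YangMills.Theorems.VirialFluxGap.FrameHessian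

end
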